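import Summits.ResolutionOfSingularities.ResolutionOfSingularities.Theorems.PurelyInseparableDim4Perm2BoundSharp
import Mathlib.Algebra.CharP.Lemmas
import HarnessLib

/-!
# [OURS · res-dim4-pi PR-2, part 5b] The translated PERM2-0 bound is attained, every `p`, every exponent —
  the STEP at `x₄ = 1` in characteristic `p`, equality in part 3's bound, and the cell's words

Sequel of `…Perm2BoundSharp` (part 5a: the data `SharpFamily.E₁ … B₁`, `parent`, `pt` and the parent's
bookkeeping over any field — clean, `x^ρ ∣ F`, `ord₀ F = 2q`, `d = q`, `ord_{(x₂,x₄)} F = q = Σ_S r`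
(condition (1) tight, (2) FAILS), no permissible coordinate hyperplane). HERE (`q = p^{e+1}`, `m = pᵉ`,
`n + m = q`, characteristic `p`):
* §4 the factored form `F = x₂ⁿx₄ᵐ(x₂ − x₄ + x₁x₃)^q` (`parent_F_eq`), the chart transform in the
  `x₂`-chart of the blow-up of `V(z, x₂, x₄)`, the transform at the point `x₄ = 1`:
  `(x₄ + 1)^m (x₁x₃ − x₂x₄)^q = x₁^q x₃^q x₄ᵐ + x₁^q x₃^q − x₂^q x₄^{q+m} − x₂^q x₄^q` (freshman's dream
  twice, `pointTransform_parent`), the point is equimultiple, the cleaning deletes exactly the two `q`-th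
  powers: `F′ = x₁^q x₃^q x₄ᵐ − x₂^q x₄^{q+m}`, `r′ = 0`, `exc′ = {x₂}`, `ord₀ F′ = d′ = 2q + m`;
* §5 **`translatedBound_attained`**: every hypothesis of part 3's `Perm2Bound.shade_step_add_le_two_mul_add_pow`
  (p648595) holds for `(parent, S = {x₂,x₄}, chart x₂, point x₄ = 1)` with `g = 0`, and its conclusion
  `d′ + g ≤ 2d + p^{(e+1)−1}` is an EQUALITY (`d = q`, `d′ = 2q + pᵉ`); `shadeIncreases_parent`;
* §6 cell words: `isMode1hCentre_parent`, `not_perm2_parent`, `step1h_parent`, and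
  **`exists_step1h_shade_eq`**: for every prime `p` and every `e`, a MODE-1h edge with perm2 = 0 and
  RISE:d `p^{e+1} ↦ 2p^{e+1} + pᵉ`; **`exists_step1h_shade_eq_two_mul_add_one`** (class of record,
  `e + 1 = 1`): RISE:d `p ↦ 2p + 1` for EVERY `p` — for `p = 2` the census specimen J-005 «C0-T (+3)»
  (`…ZooCertJ005.exists_step1h_shade_add_three`, p651175, by `decide`; not restated).

[OURS · counted 0 · AI work weaker than expert review] NOTHING here proves resolution of singularities in
dimension ≥ 4 / characteristic `p`: an exact law of the letter `d` of OUR candidate frame (MODE 1h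
coordinate game); census value (crit-3's BANK LAW at translated points, BANK-A3-01, is optimal for every
`p`, `e`). bears_on: LADDER-RESOLUTION:D157-DOOR2 (res-dim4-pi · PR-2). Supports
stmt-ResolutionOfSingularities-16155 (helper).
-/

noncomputable section

set_option linter.dupNamespace false -- mandated namespace of this single-conjunct summit
open MvPolynomial Finset
open scoped BigOperators

namespace Summit.ResolutionOfSingularities.ResolutionOfSingularities.Theorems.PIDim4
namespace Perm2Bound
open Literature.AlgebraicGeometry.Resolution
open Literature.AlgebraicGeometry.Resolution.CentreBlowup
open Literature.AlgebraicGeometry.Resolution.Hauser2010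

namespace SharpFamily

/-! ### §4 In characteristic `p`: the factored form, the transform at `x₄ = 1`, the child -/

section Step
variable {K : Type*} [Field K] [DecidableEq K] (p : ℕ) [hp : Fact p.Prime] [CharP K p]

/-- the numerics of `q = p^{e+1}`, `m = pᵉ`, `n + m = q`: `0 < m < q`, `0 < n < q`. [folklore] -/
theorem numerics (e : ℕ) {q m n : ℕ} (hq : q = p ^ (e + 1)) (hm : m = p ^ e) (hn : n + m = q) :
    0 < m ∧ m < q ∧ 0 < n ∧ n < q ∧ 0 < q := by
  have hp1 : 1 < p := hp.out.one_lt
  have hm0 : 0 < m := by rw [hm]; exact pow_pos hp.out.pos _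
  have hqm : q = m * p := by rw [hq, hm, pow_succ]
  have h2 : m * 2 ≤ m * p := Nat.mul_le_mul_left m hp1
  omega

omit [DecidableEq K] in
/-- **The factored form**: `F = x₂ⁿ x₄ᵐ (x₂ − x₄ + x₁x₃)^q` in characteristic `p` (`q = p^{e+1}`; two
applications of the freshman's dream). [folklore] -/
theorem parent_F_eq (e : ℕ) {q m n : ℕ} (hq : q = p ^ (e + 1)) :
    (parent q n m K).F = X 1 ^ n * X 3 ^ m * (X 1 - X 3 + X 0 * X 2) ^ q := by
  have hfrob : (X 1 - X 3 + X 0 * X 2 : MvPolynomial (Fin 4) K) ^ q =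
      X 1 ^ q - X 3 ^ q + X 0 ^ q * X 2 ^ q := by
    rw [hq, show (X 1 - X 3 + X 0 * X 2 : MvPolynomial (Fin 4) K) = (X 1 + X 0 * X 2) - X 3 by ring,
      sub_pow_char_pow, add_pow_char_pow, mul_pow]
    ring
  have hX : X 1 ^ n * X 3 ^ m * (X 1 - X 3 + X 0 * X 2) ^ q =
      (X 1 ^ (q + n) * X 3 ^ m - X 1 ^ n * X 3 ^ (q + m) +
        X 0 ^ q * X 1 ^ n * X 2 ^ q * X 3 ^ m : MvPolynomial (Fin 4) K) := by
    rw [hfrob]; ring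
  rw [hX]
  show monomial (E₁ q n m) (1 : K) - monomial (E₂ q n m) 1 + monomial (E₃ q n m) 1 = _
  simp only [E₁, E₂, E₃, X_pow_eq_monomial, monomial_mul, mul_one]

omit [DecidableEq K] hp [CharP K p] in
/-- the chart transform of the parent in the `x₂`-chart of the blow-up of `V(z, x₂, x₄)`:
`x₂^q x₄ᵐ − x₂^q x₄^{q+m} + x₁^q x₃^q x₄ᵐ` (`n + m = q`). [folklore] -/
theorem chartTransform_parent {q m n : ℕ} (hn : n + m = q) :
    chartTransform q ({1, 3} : Finset (Fin 4)) 1 (parent q n m K).F =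
      X 1 ^ q * X 3 ^ m - X 1 ^ q * X 3 ^ (q + m) + X 0 ^ q * X 2 ^ q * X 3 ^ m := by
  have hχ₁ : chartExponent q ({1, 3} : Finset (Fin 4)) 1 (E₁ q n m) =
      Finsupp.single 1 q + Finsupp.single 3 m := by
    ext i
    rw [chartExponent_apply, degIn_S, (E₁_apply q n m).2.1, (E₁_apply q n m).2.2.2]
    by_cases hi : i = 1
    · rw [if_pos hi, hi]; simp; omega
    · rw [if_neg hi]; unfold E₁
      simp only [Finsupp.add_apply, Finsupp.single_apply, if_neg (Ne.symm hi)]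
  have hχ₂ : chartExponent q ({1, 3} : Finset (Fin 4)) 1 (E₂ q n m) =
      Finsupp.single 1 q + Finsupp.single 3 (q + m) := by
    ext i
    rw [chartExponent_apply, degIn_S, (E₂_apply q n m).2.1, (E₂_apply q n m).2.2.2]
    by_cases hi : i = 1
    · rw [if_pos hi, hi]; simp; omega
    · rw [if_neg hi]; unfold E₂
      simp only [Finsupp.add_apply, Finsupp.single_apply, if_neg (Ne.symm hi)]
  have hχ₃ : chartExponent q ({1, 3} : Finset (Fin 4)) 1 (E₃ q n m) =
      Finsupp.single 0 q + Finsupp.single 2 q + Finsupp.single 3 m := by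
    ext i
    rw [chartExponent_apply, degIn_S, (E₃_apply q n m).2.1, (E₃_apply q n m).2.2.2]
    by_cases hi : i = 1
    · rw [if_pos hi, hi]; simp; omega
    · rw [if_neg hi]; unfold E₃
      simp only [Finsupp.add_apply, Finsupp.single_apply, if_neg (Ne.symm hi), add_zero]
  have hsub : (monomial (E₁ q n m) (1 : K) - monomial (E₂ q n m) 1) =
      monomial (E₁ q n m) 1 + monomial (E₂ q n m) (-1) := by
    rw [sub_eq_add_neg, ← map_neg]
  show chartTransform q _ 1 (monomial (E₁ q n m) 1 - monomial (E₂ q n m) 1 + monomial (E₃ q n m) 1) = _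
  rw [hsub, chartTransform_add, chartTransform_add, chartTransform_monomial, chartTransform_monomial,
    chartTransform_monomial, hχ₁, hχ₂, hχ₃, map_neg, ← sub_eq_add_neg]
  simp only [X_pow_eq_monomial, monomial_mul, mul_one]

omit [DecidableEq K] in
/-- **the transform at the point `x₄ = 1` of the `x₂`-chart**: `(x₄ + 1)^m(x₁x₃ − x₂x₄)^q` expanded by the
freshman's dream: `x₁^q x₃^q x₄ᵐ + x₁^q x₃^q − x₂^q x₄^{q+m} − x₂^q x₄^q`. [folklore] -/
theorem pointTransform_parent (e : ℕ) {q m n : ℕ} (hq : q = p ^ (e + 1)) (hm : m = p ^ e)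
    (hn : n + m = q) :
    pointTransform q ({1, 3} : Finset (Fin 4)) 1 (pt K) (parent q n m K) =
      monomial (A₃ q m) 1 + monomial (B₀ q) 1 - monomial (A₂ q m) 1 - monomial (B₁ q) 1 := by
  have hX : (monomial (A₃ q m) 1 + monomial (B₀ q) 1 - monomial (A₂ q m) 1 - monomial (B₁ q) 1 :
      MvPolynomial (Fin 4) K) =
      X 0 ^ q * X 2 ^ q * X 3 ^ m + X 0 ^ q * X 2 ^ q - X 1 ^ q * X 3 ^ (q + m) - X 1 ^ q * X 3 ^ q := by
    simp only [A₃, B₀, A₂, B₁, X_pow_eq_monomial, monomial_mul, mul_one]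
  have hfr_m : (X 3 + 1 : MvPolynomial (Fin 4) K) ^ m = X 3 ^ m + 1 := by
    rw [hm, add_pow_char_pow, one_pow]
  have hfr_q : (X 3 + 1 : MvPolynomial (Fin 4) K) ^ q = X 3 ^ q + 1 := by
    rw [hq, add_pow_char_pow, one_pow]
  rw [hX]
  show PointBlowup.translate (pt K) (chartTransform q ({1, 3} : Finset (Fin 4)) 1 (parent q n m K).F) = _
  rw [chartTransform_parent hn]
  unfold PointBlowup.translate pt
  simp only [map_add, map_sub, map_mul, map_pow, aeval_X]
  simp only [show ((1 : Fin 4) = 3) = False from propext ⟨by decide, False.elim⟩,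
    show ((0 : Fin 4) = 3) = False from propext ⟨by decide, False.elim⟩,
    show ((2 : Fin 4) = 3) = False from propext ⟨by decide, False.elim⟩, if_false, if_true,
    map_zero, add_zero, map_one]
  rw [pow_add, hfr_m, hfr_q]
  ring

omit [DecidableEq K] in
/-- **the point `x₄ = 1` is equimultiple**: every monomial of the transform has degree `≥ 2q > q`. [folklore] -/
theorem isEquimultiplePoint_parent (e : ℕ) {q m n : ℕ} (hq : q = p ^ (e + 1)) (hm : m = p ^ e)
    (hn : n + m = q) : IsEquimultiplePoint q ({1, 3} : Finset (Fin 4)) 1 (pt K) (parent q n m K) := by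
  obtain ⟨-, -, -, -, hq0⟩ := numerics p e hq hm hn
  obtain ⟨-, -, -, -, hdA₃, hdA₂, hdB₀, hdB₁⟩ := degrees q n m
  intro d _ hdlt
  rw [pointTransform_parent p e hq hm hn, coeff_sub, coeff_sub, coeff_add, coeff_monomial,
    coeff_monomial, coeff_monomial, coeff_monomial]
  have h1 : ¬ A₃ q m = d := fun h => by rw [← h, hdA₃] at hdlt; omega
  have h2 : ¬ B₀ q = d := fun h => by rw [← h, hdB₀] at hdlt; omega
  have h3 : ¬ A₂ q m = d := fun h => by rw [← h, hdA₂] at hdlt; omega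
  have h4 : ¬ B₁ q = d := fun h => by rw [← h, hdB₁] at hdlt; omega
  rw [if_neg h1, if_neg h2, if_neg h3, if_neg h4]; ring

/-- **the child's residual polynomial**: the cleaning deletes exactly the two `q`-th powers `x₁^q x₃^q`
and `x₂^q x₄^q`: `F′ = x₁^q x₃^q x₄ᵐ − x₂^q x₄^{q+m} = x₄ᵐ (x₁^q x₃^q − x₂^q x₄^q)`. [folklore] -/
theorem step_parent_F (e : ℕ) {q m n : ℕ} (hq : q = p ^ (e + 1)) (hm : m = p ^ e) (hn : n + m = q) :
    (step q ({1, 3} : Finset (Fin 4)) 1 (pt K) (parent q n m K)).F =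
      monomial (A₃ q m) 1 - monomial (A₂ q m) 1 := by
  obtain ⟨hm0, hmq, -, -, -⟩ := numerics p e hq hm hn
  have hndm : ¬ q ∣ m := fun h => absurd (Nat.le_of_dvd hm0 h) (not_le.mpr hmq)
  have hndqm : ¬ q ∣ q + m := fun h => hndm ((Nat.dvd_add_right (dvd_refl q)).mp h)
  have hPB₀ : IsPthPowerExponent q (B₀ q) := by
    rw [isPthPowerExponent_iff]; intro i
    unfold B₀
    rw [Finsupp.add_apply, Finsupp.single_apply, Finsupp.single_apply]
    split_ifs <;> simp
  have hPB₁ : IsPthPowerExponent q (B₁ q) := by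
    rw [isPthPowerExponent_iff]; intro i
    unfold B₁
    rw [Finsupp.add_apply, Finsupp.single_apply, Finsupp.single_apply]
    split_ifs <;> simp
  have hnPA₃ : ¬ IsPthPowerExponent q (A₃ q m) := fun h =>
    hndm ((A₃_apply q m).2.2.2 ▸ (isPthPowerExponent_iff q _).mp h 3)
  have hnPA₂ : ¬ IsPthPowerExponent q (A₂ q m) := fun h =>
    hndqm ((A₂_apply q m).2.2.2 ▸ (isPthPowerExponent_iff q _).mp h 3)
  have hsub : (monomial (A₃ q m) (1 : K) + monomial (B₀ q) 1 - monomial (A₂ q m) 1 - monomial (B₁ q) 1)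
      = monomial (A₃ q m) 1 + monomial (B₀ q) 1 + monomial (A₂ q m) (-1) + monomial (B₁ q) (-1) := by
    rw [sub_eq_add_neg, sub_eq_add_neg, ← map_neg, ← map_neg]
  show deletePthPowers q (pointTransform q _ 1 (pt K) (parent q n m K)) = _
  rw [pointTransform_parent p e hq hm hn, hsub, deletePthPowers_add, deletePthPowers_add,
    deletePthPowers_add, deletePthPowers_monomial, deletePthPowers_monomial, deletePthPowers_monomial,
    deletePthPowers_monomial, if_neg hnPA₃, if_pos hPB₀, if_neg hnPA₂, if_pos hPB₁, add_zero, add_zero,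
    map_neg, ← sub_eq_add_neg]

omit hp [CharP K p] in
/-- **the child's multiplicities**: `x₄` is lost (translated), `x₂` is re-read with `ord_S F − q = 0`:
`r′ = 0`. [folklore] -/
theorem step_parent_r {q m n : ℕ} (hn : n + m = q) (hq : 0 < q) :
    (step q ({1, 3} : Finset (Fin 4)) 1 (pt K) (parent q n m K)).r = 0 := by
  show newMult q _ 1 (pt K) (parent q n m K) = 0
  unfold newMult
  rw [ordAlong_parent n hn hq, ENat.toNat_coe, Nat.sub_self]
  ext i
  rw [Finsupp.update_apply, Finsupp.filter_apply, Finsupp.coe_zero, Pi.zero_apply]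
  by_cases hi : i = 1
  · rw [if_pos hi]
  · rw [if_neg hi]
    show (if pt K i = 0 then rvec n m i else 0) = 0
    unfold pt rvec
    by_cases hi3 : i = 3
    · rw [if_pos hi3, if_neg one_ne_zero]
    · rw [if_neg hi3, if_pos rfl, Finsupp.add_apply, Finsupp.single_apply, Finsupp.single_apply,
        if_neg (Ne.symm hi), if_neg (Ne.symm hi3), add_zero]

omit [DecidableEq K] hp [CharP K p] in
/-- **the child's components**: `exc′ = {x₂}`. [folklore] -/
theorem step_parent_exc (q n m : ℕ) [DecidableEq K] :
    (step q ({1, 3} : Finset (Fin 4)) 1 (pt K) (parent q n m K)).exc = {1} := by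
  show newExc 1 (pt K) (parent q n m K) = {1}
  unfold newExc
  ext i
  simp only [Finset.mem_insert, Finset.mem_filter, Finset.mem_singleton]
  constructor
  · rintro (h | ⟨h, hbi⟩)
    · exact h
    · change i ∈ ({1, 3} : Finset (Fin 4)) at h
      rw [Finset.mem_insert, Finset.mem_singleton] at h
      rcases h with h | h
      · exact h
      · exfalso
        rw [h] at hbi
        unfold pt at hbi
        rw [if_pos rfl] at hbi
        exact one_ne_zero hbi
  · intro h; exact Or.inl h

/-- **`ord₀ F′ = 2q + m`** for the child. [folklore] -/
theorem ordZero_step_parent (e : ℕ) {q m n : ℕ} (hq : q = p ^ (e + 1)) (hm : m = p ^ e)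
    (hn : n + m = q) :
    ordZero (step q ({1, 3} : Finset (Fin 4)) 1 (pt K) (parent q n m K)).F = ((2 * q + m : ℕ) : ℕ∞) := by
  obtain ⟨-, -, -, -, hq0⟩ := numerics p e hq hm hn
  obtain ⟨-, -, -, -, hdA₃, hdA₂, -, -⟩ := degrees q n m
  have hne := (ne_facts n hq0 (m := m)).2.2.2
  rw [step_parent_F p e hq hm hn, ordZero_eq_nat_iff]
  refine ⟨⟨A₃ q m, ?_, by rw [hdA₃]; omega⟩, fun d hd => ?_⟩
  · rw [coeff_sub, coeff_monomial, coeff_monomial, if_pos rfl, if_neg (Ne.symm hne)]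
    norm_num
  · rw [coeff_sub, coeff_monomial, coeff_monomial]
    have h1 : ¬ A₃ q m = d := fun h => by rw [← h, hdA₃] at hd; omega
    have h2 : ¬ A₂ q m = d := fun h => by rw [← h, hdA₂] at hd; omega
    rw [if_neg h1, if_neg h2]; ring

/-- **`d′ = 2q + m`**: the child's shade. [folklore] -/
theorem shade_step_parent (e : ℕ) {q m n : ℕ} (hq : q = p ^ (e + 1)) (hm : m = p ^ e)
    (hn : n + m = q) :
    (step q ({1, 3} : Finset (Fin 4)) 1 (pt K) (parent q n m K)).shade = ((2 * q + m : ℕ) : ℕ∞) := by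
  obtain ⟨-, -, -, -, hq0⟩ := numerics p e hq hm hn
  show ordZero (step q _ 1 (pt K) (parent q n m K)).F -
      ((step q _ 1 (pt K) (parent q n m K)).r.degree : ℕ∞) = _
  rw [ordZero_step_parent p e hq hm hn, step_parent_r hn hq0, map_zero, Nat.cast_zero, tsub_zero]

end Step

/-! ### §5 Equality in part 3's bound, every `p`, every exponent -/

section Attained
variable {K : Type*} [Field K] [DecidableEq K] (p : ℕ) [hp : Fact p.Prime] [CharP K p]

/-- `pᵉ(p − 1) + pᵉ = p^{e+1}`. [folklore] -/
theorem pow_mul_pred_add_pow (e : ℕ) : p ^ e * (p - 1) + p ^ e = p ^ (e + 1) := by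
  rw [← mul_add_one, Nat.sub_add_cancel hp.out.one_lt.le, pow_succ]

/-- **THE TRANSLATED PERM2-0 BOUND `d′ ≤ 2d − g + p^{e−1}` IS ATTAINED, for every prime `p` and every
exponent `e + 1`.** For the parent state of the family (`q = p^{e+1}`, `m = pᵉ`, `n = pᵉ(p − 1)`), the
plane centre `S = {x₂, x₄}`, the `x₂`-chart and the point `x₄ = 1`: ALL hypotheses of part 3's
`Perm2Bound.shade_step_add_le_two_mul_add_pow` hold (listed verbatim, with `g = 0`), and its conclusion
`d′ + g ≤ 2d + p^{(e+1)−1}` holds with EQUALITY: `d = q`, `d′ = 2q + pᵉ`. [folklore] -/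
theorem translatedBound_attained (e : ℕ) :
    let q : ℕ := p ^ (e + 1)
    let S : Finset (Fin 4) := {1, 3}
    let s : CState (Fin 4) K := parent q (p ^ e * (p - 1)) (p ^ e) K
    (1 ≤ e + 1 ∧ (1 : Fin 4) ∈ S ∧ pt K 1 = 0 ∧ (∀ i, i ∉ S → pt K i = 0) ∧
      deletePthPowers q s.F = s.F ∧ ordZero s.F = ((2 * q : ℕ) : ℕ∞) ∧
      (∀ d ∈ s.F.support, s.r ≤ d) ∧ (∀ d ∈ s.F.support, q ≤ degIn S d) ∧
      ordAlong S s.F = ((degIn S s.r + 0 : ℕ) : ℕ∞)) ∧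
    (step q S 1 (pt K) s).shade + ((0 : ℕ) : ℕ∞) = 2 * s.shade + ((p ^ (e + 1 - 1) : ℕ) : ℕ∞) ∧
    s.shade = (q : ℕ∞) ∧ (step q S 1 (pt K) s).shade = ((2 * q + p ^ e : ℕ) : ℕ∞) := by
  intro q S s
  have hn : p ^ e * (p - 1) + p ^ e = q := pow_mul_pred_add_pow p e
  obtain ⟨hm0, hmq, hn0, hnq, hq0⟩ := numerics p e (q := q) rfl rfl hn
  have hshade : s.shade = (q : ℕ∞) := shade_parent _ hn hq0
  have hshade1 : (step q S 1 (pt K) s).shade = ((2 * q + p ^ e : ℕ) : ℕ∞) :=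
    shade_step_parent p e rfl rfl hn
  refine ⟨⟨by omega, by decide, ?_, ?_, deletePthPowers_parent _ hm0 hmq hn0 hnq, ordZero_parent _ hn hq0,
    parent_r_le _, le_degIn_parent _ hn, ?_⟩, ?_, hshade, hshade1⟩
  · show (if (1 : Fin 4) = 3 then (1 : K) else 0) = 0
    rw [if_neg (by decide)]
  · intro i hi
    show (if i = 3 then (1 : K) else 0) = 0
    rw [if_neg]
    rintro rfl
    exact hi (by decide)
  · rw [ordAlong_parent _ hn hq0, degIn_parent_r _ hn, add_zero]
  · rw [hshade1, hshade, Nat.add_sub_cancel, Nat.cast_zero, add_zero]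
    norm_cast

/-- **The shade INCREASES by `q + pᵉ`** at this MODE-1h edge (a kangaroo phenomenon of the coordinate game
outside condition (2): `d ↦ 2d + pᵉ`). [folklore] -/
theorem shadeIncreases_parent (e : ℕ) {q m n : ℕ} (hq : q = p ^ (e + 1)) (hm : m = p ^ e)
    (hn : n + m = q) : ShadeIncreases q ({1, 3} : Finset (Fin 4)) 1 (pt K) (parent q n m K) := by
  obtain ⟨-, -, -, -, hq0⟩ := numerics p e hq hm hn
  unfold ShadeIncreases
  rw [shade_parent n hn hq0, shade_step_parent p e hq hm hn]
  exact_mod_cast (show q < 2 * q + m by omega)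

end Attained

end SharpFamily

/-! ### §6 In the cell's vocabulary: a MODE-1h RISE:d `q ↦ 2q + pᵉ` with perm2 = 0, every `p`, `e` -/

section Cell
open SharpFamily
variable {K : Type} [Field K] [DecidableEq K] (p : ℕ) [hp : Fact p.Prime] [CharP K p]

omit [DecidableEq K] [CharP K p] in
/-- **The plane `V(z, x₂, x₄)` is a MODE-1h centre of record for the parent**: Hironaka-permissible
(`ord_S F = q`) and of least cardinality (no coordinate hyperplane is permissible). [folklore] -/
theorem isMode1hCentre_parent (e : ℕ) {q m n : ℕ} (hq : q = p ^ (e + 1)) (hm : m = p ^ e)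
    (hn : n + m = q) : IsMode1hCentre q ({1, 3} : Finset (Fin 4)) (parent q n m K).F := by
  obtain ⟨hm0, -, hn0, -, hq0⟩ := numerics p e hq hm hn
  refine ⟨⟨⟨1, by decide⟩, by rw [ordAlong_parent n hn hq0]⟩, fun S' hS' => ?_⟩
  obtain ⟨hne, hord⟩ := hS'
  rw [Finset.card_pair (by decide)]
  by_contra hlt
  have hcard : S'.card = 1 := by
    have := Finset.card_pos.mpr hne
    omega
  obtain ⟨i, rfl⟩ := Finset.card_eq_one.mp hcard
  exact absurd hord (not_le.mpr (ordAlong_singleton_parent_lt n hn hm0 hn0 i))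

omit [DecidableEq K] [CharP K p] in
/-- **perm2 = 0**: Hauser–Perlega's condition (2) fails for the parent and the plane centre. [folklore] -/
theorem not_perm2_parent (e : ℕ) {q m n : ℕ} (hq : q = p ^ (e + 1)) (hm : m = p ^ e)
    (hn : n + m = q) : ¬ Perm2 ({1, 3} : Finset (Fin 4)) (parent q n m K) := by
  obtain ⟨-, -, -, -, hq0⟩ := numerics p e hq hm hn
  exact SharpFamily.not_perm2_parent n hn hq0

/-- **The edge of the family is a MODE-1h step** `parent ⟶ child` (plane centre `V(z, x₂, x₄)`, `x₂`-chart,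
point `x₄ = 1`). [folklore] -/
theorem step1h_parent (e : ℕ) {q m n : ℕ} (hq : q = p ^ (e + 1)) (hm : m = p ^ e) (hn : n + m = q) :
    Step1h q (parent q n m K) (CentreBlowup.step q ({1, 3} : Finset (Fin 4)) 1 (pt K) (parent q n m K)) := by
  refine ⟨{1, 3}, isMode1hCentre_parent p e hq hm hn, 1, pt K, by decide, ?_,
    isEquimultiplePoint_parent p e hq hm hn, ?_, rfl⟩
  · show (if (1 : Fin 4) = 3 then (1 : K) else 0) = 0
    rw [if_neg (by decide)]
  · exact ne_zero_of_ordZero_eq_natCast (ordZero_step_parent p e hq hm hn)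

/-- **RISE:d `q ↦ 2q + pᵉ` on a MODE-1h edge with perm2 = 0, for every prime `p` and every exponent
`e + 1`** (`q = p^{e+1}`): part 3's translated bound `2d − g + p^{(e+1)−1}` is attained in the class
(4, e+1). [folklore] -/
theorem exists_step1h_shade_eq (e : ℕ) :
    ∃ s s' : State K, Step1h (p ^ (e + 1)) s s' ∧ ¬ Perm2 ({1, 3} : Finset (Fin 4)) s ∧
      s.shade = ((p ^ (e + 1) : ℕ) : ℕ∞) ∧ s'.shade = ((2 * p ^ (e + 1) + p ^ e : ℕ) : ℕ∞) ∧ RiseD s s' := by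
  have hn : p ^ e * (p - 1) + p ^ e = p ^ (e + 1) := pow_mul_pred_add_pow p e
  obtain ⟨-, -, -, -, hq0⟩ := numerics p e (q := p ^ (e + 1)) rfl rfl hn
  refine ⟨parent (p ^ (e + 1)) (p ^ e * (p - 1)) (p ^ e) K, _, step1h_parent p e rfl rfl hn,
    not_perm2_parent p e rfl rfl hn, shade_parent _ hn hq0, shade_step_parent p e rfl rfl hn, ?_⟩
  unfold RiseD
  exact shadeIncreases_parent p e rfl rfl hn

/-- **The class of record (`e + 1 = 1`, multiplicity `p`): RISE:d `p ↦ 2p + 1` on a MODE-1h edge with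
perm2 = 0, for EVERY prime `p`** — `2d − g + 1` attained (`d = p`, `g = 0`); for `p = 2` this is the census
specimen J-005 «C0-T (+3)» (`…ZooCertJ005.exists_step1h_shade_add_three`, shade `2 ↦ 5`). [folklore] -/
theorem exists_step1h_shade_eq_two_mul_add_one :
    ∃ s s' : State K, Step1h p s s' ∧ ¬ Perm2 ({1, 3} : Finset (Fin 4)) s ∧
      s.shade = (p : ℕ∞) ∧ s'.shade = ((2 * p + 1 : ℕ) : ℕ∞) ∧ RiseD s s' := by
  obtain ⟨s, s', h1, h2, h3, h4, h5⟩ := exists_step1h_shade_eq (K := K) p 0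
  refine ⟨s, s', ?_, h2, ?_, ?_, h5⟩
  · simpa using h1
  · simpa using h3
  · simpa using h4

end Cell

end Perm2Bound

end Summit.ResolutionOfSingularities.ResolutionOfSingularities.Theorems.PIDim4

end
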